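import Mathlib
import HarnessLib
import Summits.HubbardSuperconductivity.HubbardSuperconductivity.Theorems.KLProgrammeKLRegimeVolumeLimitHOscOfEngineOsc
import Summits.HubbardSuperconductivity.HubbardSuperconductivity.Theorems.KLProgrammeKLRegimeVolumeLimitV12HE1FreeRetyped
import Summits.HubbardSuperconductivity.HubbardSuperconductivity.Theorems.KLProgrammeKLRegimeVolumeLimitV11HE1OfTopFrameTower

/-!
# Route `KLProgramme` — VL item stmt-HubbardSuperconductivity-23356 `KLRegimeVolumeLimitV17F3` (skeleton «cauchy» v12W-9, 3fe75b6ca60710d7):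
# BOTH ENGINE-LINEAGE ATOMS FROM ONE ENGINE TEXT «ENG-X» = `EngineP4 klPredsV17F2 klWindowC` WITH THE (K5′) OSC EXPORT AND THE TOP-FRAME READ-OUT EXPORT
# (cell gate-hubbard-kl, seat hubbard-kl-k3c4-p1 g21, VL lead; located point «(VL)-HE1FREE-SUPPLY»)

STATE.  v12W-9's open content is two atoms: `stub_vl_flowPieceOscTE` — WIRED to the registered engine image r16 of stmt-…-20437 (§C export
`flowPieceOsc_hist_of_stubs_v2x` ↦ ENG-OSC ↦ p2 g25's `hoscTAtom_of_engineOsc`) — and `stub_vl_HE1free` (re-typed, 17cc1cbcff73) — wired to NOTHING registered: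
(b) `stub_engine_step_norms` exports `KernelNormsWt4 … (K_n) j` (the action `𝒱_j[K_n]` read at family `F_j`, rate `j`), whereas HE1free′ reads `𝒱_{j+1}[K_top]` at
`(F_j, rate j)` — the blocked tower's INPUT STATE (E1-LEVELS-BLUEPRINT g8 §2), for which no re-analysis bridge from the `(F_{j+1}, rate j+1)` read-out exists
(`F_{j+1}` is not a partition of unity on the shell `(Λ_{j+2}, Λ_{j+1}]` that the VL block step integrates).  So ONE engine-lane theorem is owed — the
TOP-FRAME READ-OUT ROW «ROW-T» at scale `n` in (b)'s binders — and everything else is composition.  This file is that composition, TOKEN-GENERIC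
(no engine token named), against ONE history-bound engine text:

**ENG-X** := the text of `EngineP4 klPredsV17F2 klWindowC` with, after `∃ c₃ > 0`, the two existentials `∃ c″ ≥ 0, ∃ C₀ ≥ 0` and, in the conclusion at scale `n`,
after `(engine ∧ twoLeg)`: the osc history `∀ m, 1 ≤ m → m < n → FlowPieceOscAt L M c″ β U μ m` (= ENG-OSC's clause) ∧ the units `Z^{K_n}_{Λ_{k+1}} ≠ 0` (`k < n`)
∧ the read-outs `klWtPinnedSumAt … K_n j j (2p) (𝒱_{j+1}[K_n]) q w ≤ C₀·klWtBudget P Q U (j+1) (2p)` (`j < n`, `p ≥ 2`) ∧ the degree-`2` read-outs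
`≤ C₀·Q.CE·ε_n·4^{−(j+1)}` (`j < n`).  From the engine image it is `engine_slots_of_stubs_v2x` + `flowPieceOsc_hist_of_stubs_v2x` + ROW-T (one §C corollary).
KEYING.  Children 1/2 CHOOSE `(P₁, R₂)`, so the bootstrap yields the law keyed at `P₁`; the package-free atom is keyed at the VL binder's `P`.  Since `P` enters
only through `Klam` (`ε_P = (P.Klam/P₁.Klam)·ε_{P₁}`… i.e. `ε_{P₁} = r·ε_P`, `r := P₁.Klam/P.Klam`), the law transports to ANY `P` with the package
`Q₁ := {Q with CE := max 1 r · Q.CE}` (`klWtBudget_two_mul_le_rescale`: `CE^p (rε)^{max(1,p−1)} ≤ (max 1 r·CE)^p ε^{max(1,p−1)}` for `p ≥ 1`).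

* `klWtBudget_two_mul_le_rescale`, `ce_mul_epsCoupling_le_rescale` — the `Klam`-transport of the even-degree law / of the degree-`2` bound;
* `engineP4_of_engineP4X`, **`engineOsc_of_engineP4X`** — ENG-X ⇒ `EngineP4 …` / ⇒ ENG-OSC (drop conjuncts): nothing is lost, p2's closers apply;
* **`htopFree'_of_children`** — children 1 (`BetaSplitP`, ✓ 20438) + 2 (`CountertermP2`, ✓ 20439) + ENG-X ⇒ the package-free top-frame export **HtopEvenFree′**
  (`Z ≠ 0` at every `k ≤ n_β`; read-outs of `𝒱_{j+1}[K_{n_β+1}]` at `(F_j, rate j)` in law units, degree `2` at `ε_{n_β+1}`; `j ≤ n_β`) — `inductionP4`'s tower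
  half VERBATIM (= p2's `hoscAtom_of_children`), export read at `n = n_β + 1`, then transported to the outer `P`;
(The packaging HtopEvenFree′ ⇒ `stub_vl_HE1free`'s text and the two atom closers `he1free'_of_engineP4X` / `oscTE_of_engineP4X` are the sibling file
`…VolumeLimitV12AtomsOfEngineTop`.)

Pure composition; no definition; nothing here asserts ENG-X, ROW-T, either atom, any stub of 20437, VL, K3 or superconductivity.
References: BGM 2006 §2.4 (2.36), §2.8 (2.83), §3 [cite: BenfattoGiulianiMastropietro2006].
-/

noncomputable section

namespace Summit.HubbardSuperconductivity.HubbardSuperconductivity.Theorems.KLRegimeSplit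

set_option linter.dupNamespace false -- summit = problem name (single-conjunct summit), D-0017

open Real Finset Literature.MathematicalPhysics.QuantumLattice Literature.Probability.LatticeModels GrassmannAlgebra
open Literature.MathematicalPhysics.QuantumLattice.FermiRG
open Summit.HubbardSuperconductivity.HubbardSuperconductivity.Theorems.KLProgrammeLegKernels
open Summit.HubbardSuperconductivity.HubbardSuperconductivity.Theorems.DispersionFlow
open Summit.HubbardSuperconductivity.HubbardSuperconductivity.Theorems.EngineV8
open Summit.HubbardSuperconductivity.HubbardSuperconductivity.Theorems.TwoVolumeSource

/-! ## §0 `Klam`-transport of the budget between split records -/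

/-- `ε_{P₁} = (P₁.Klam / P₀.Klam) · ε_{P₀}` (`P₀.Klam ≠ 0`). [folklore] -/
theorem epsCoupling_eq_ratio_mul {P₀ P₁ : SplitConsts} (h₀ : P₀.Klam ≠ 0) (U : ℝ) (n : ℕ) :
    epsCoupling P₁ U n = P₁.Klam / P₀.Klam * epsCoupling P₀ U n := by
  unfold epsCoupling
  field_simp

/-- **Transport of the even-degree law**: for `1 ≤ p`, `1 ≤ P₀.Klam`, `0 ≤ P₁.Klam`, `0 ≤ Q.CE`,
`klWtBudget P₁ Q U j (2p) ≤ klWtBudget P₀ {Q with CE := max 1 (P₁.Klam/P₀.Klam)·Q.CE} U j (2p)`. [folklore: `r^{max(1,p−1)} ≤ (max 1 r)^p`] -/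
theorem klWtBudget_two_mul_le_rescale {P₀ P₁ : SplitConsts} {Q : EngConsts} (hCE : 0 ≤ Q.CE) (h₀ : 1 ≤ P₀.Klam) (h₁ : 0 ≤ P₁.Klam)
    (U : ℝ) (j : ℕ) {p : ℕ} (hp : 1 ≤ p) :
    klWtBudget P₁ Q U j (2 * p) ≤ klWtBudget P₀ { Q with CE := max 1 (P₁.Klam / P₀.Klam) * Q.CE } U j (2 * p) := by
  have hK0 : 0 < P₀.Klam := lt_of_lt_of_le one_pos h₀
  set r : ℝ := P₁.Klam / P₀.Klam with hr
  have hr0 : 0 ≤ r := div_nonneg h₁ hK0.le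
  have hR1 : 1 ≤ max 1 r := le_max_left _ _
  have hrR : r ≤ max 1 r := le_max_right _ _
  have hε₀ : 0 ≤ epsCoupling P₀ U j := epsCoupling_nonneg' hK0.le U j
  have hε : epsCoupling P₁ U j = r * epsCoupling P₀ U j := epsCoupling_eq_ratio_mul hK0.ne' U j
  rw [klWtBudget_two_mul, klWtBudget_two_mul, hε]
  have h2 : (0 : ℝ) < (2 : ℝ) ^ ((3 * (p : ℤ) - 5) * j) := zpow_pos (by norm_num) _
  refine mul_le_mul_of_nonneg_right ?_ h2.le
  have he : max 1 (p - 1) ≤ p := max_le hp (Nat.sub_le p 1)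
  calc Q.CE ^ p * (r * epsCoupling P₀ U j) ^ max 1 (p - 1)
      = r ^ max 1 (p - 1) * (Q.CE ^ p * epsCoupling P₀ U j ^ max 1 (p - 1)) := by rw [mul_pow]; ring
    _ ≤ (max 1 r) ^ p * (Q.CE ^ p * epsCoupling P₀ U j ^ max 1 (p - 1)) := by
        refine mul_le_mul_of_nonneg_right ?_ (by positivity)
        exact (pow_le_pow_left₀ hr0 hrR _).trans (pow_le_pow_right₀ hR1 he)
    _ = (max 1 r * Q.CE) ^ p * epsCoupling P₀ U j ^ max 1 (p - 1) := by rw [mul_pow]; ring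

/-- **Transport of the degree-`2` bound**: `Q.CE·ε_{P₁}(n) ≤ (max 1 (P₁.Klam/P₀.Klam)·Q.CE)·ε_{P₀}(n)`. [folklore] -/
theorem ce_mul_epsCoupling_le_rescale {P₀ P₁ : SplitConsts} {Q : EngConsts} (hCE : 0 ≤ Q.CE) (h₀ : 1 ≤ P₀.Klam) (h₁ : 0 ≤ P₁.Klam)
    (U : ℝ) (n : ℕ) :
    Q.CE * epsCoupling P₁ U n ≤ max 1 (P₁.Klam / P₀.Klam) * Q.CE * epsCoupling P₀ U n := by
  have hK0 : 0 < P₀.Klam := lt_of_lt_of_le one_pos h₀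
  have hr0 : 0 ≤ P₁.Klam / P₀.Klam := div_nonneg h₁ hK0.le
  have hε₀ : 0 ≤ epsCoupling P₀ U n := epsCoupling_nonneg' hK0.le U n
  rw [epsCoupling_eq_ratio_mul hK0.ne' U n]
  calc Q.CE * (P₁.Klam / P₀.Klam * epsCoupling P₀ U n) = P₁.Klam / P₀.Klam * Q.CE * epsCoupling P₀ U n := by ring
    _ ≤ max 1 (P₁.Klam / P₀.Klam) * Q.CE * epsCoupling P₀ U n :=
        mul_le_mul_of_nonneg_right (mul_le_mul_of_nonneg_right (le_max_right _ _) hCE) hε₀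

/-! ## §1 ENG-X projects to the engine child and to ENG-OSC -/

set_option maxHeartbeats 800000 in -- long binders
/-- **ENG-X ⇒ `EngineP4 klPredsV17F2 klWindowC`** (forget the three exports). [folklore: projection] -/
theorem engineP4_of_engineP4X
    (hX : ∃ G : GeoConsts, G.WF ∧ ∀ P : SplitConsts, P.WF → ∀ R : RenConsts, R.WF2 → ∃ Q : EngConsts, Q.WF ∧ ∃ c₃ : ℝ, 0 < c₃ ∧
      ∃ c'' : ℝ, 0 ≤ c'' ∧ ∃ C₀ : ℝ, 0 ≤ C₀ ∧ ∀ c : ℝ, 0 < c → c ≤ c₃ →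
        ∃ U₀ : ℝ, 0 < U₀ ∧ ∃ L₃ : ℝ → ℝ → ℕ, ∃ M₃ : ℝ → ℝ → ℕ → ℕ,
          ∀ μ ∈ klWindowC, ∀ U : ℝ, 0 < U → U ≤ U₀ → ∀ β : ℝ, klBetaMin ≤ β → β ≤ Real.exp (c / U ^ 2) →
            ∀ K : TrigPolyC4v, klPredsV17F2.frameOK R U (nScales β) μ K →
              ∀ (L M : ℕ) [NeZero L] [NeZero M], L₃ β U ≤ L → M₃ β U L ≤ M →
                ∀ n : ℕ, n ≤ nScales β + 1 → IsKLRegime U c (-(n : ℤ)) → HistP klPredsV17F2 L M G P Q R β U μ K n →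
                  (klPredsV17F2.engine L M G P Q β U μ K n ∧ klPredsV17F2.twoLeg L M G P Q R β U μ K n) ∧
                  (∀ m : ℕ, 1 ≤ m → m < n → FlowPieceOscAt L M c'' β U μ m) ∧
                  (∀ k : ℕ, k < n → hubbardEffPartitionFnCT L M β U μ 0 (klFlowFrameU L M β U μ n) (klScale klE0 (k + 1)) ≠ 0) ∧
                  (∀ j : ℕ, j < n → ∀ p : ℕ, 2 ≤ p → ∀ (q : Fin (2 * p)) (w : SpaceTimeIdx L M × SectorLeg (sectorCount j)),
                    klWtPinnedSumAt L M β μ (klFlowFrameU L M β U μ n) j j (2 * p)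
                      (klEffectiveAction L M β U μ (klFlowFrameU L M β U μ n) klE0 (j + 1)) q w ≤ C₀ * klWtBudget P Q U (j + 1) (2 * p)) ∧
                  (∀ j : ℕ, j < n → ∀ (q : Fin 2) (w : SpaceTimeIdx L M × SectorLeg (sectorCount j)),
                    klWtPinnedSumAt L M β μ (klFlowFrameU L M β U μ n) j j 2
                      (klEffectiveAction L M β U μ (klFlowFrameU L M β U μ n) klE0 (j + 1)) q w ≤
                        C₀ * Q.CE * epsCoupling P U n * ((4 : ℝ) ^ (j + 1))⁻¹)) :
    EngineP4 klPredsV17F2 klWindowC := by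
  obtain ⟨G, hG, hGP⟩ := hX
  refine ⟨G, hG, fun P hP R hR => ?_⟩
  obtain ⟨Q, hQ, c₃, hc₃, c'', -, C₀, -, hc⟩ := hGP P hP R hR
  refine ⟨Q, hQ, c₃, hc₃, fun c hc' hc3 => ?_⟩
  obtain ⟨U₀, hU₀, L₃, M₃, hmain⟩ := hc c hc' hc3
  exact ⟨U₀, hU₀, L₃, M₃, fun μ hμ U hU hUle β hβ hβc K hK L M _ _ hL hM n hn hkl hhist =>
    (hmain μ hμ U hU hUle β hβ hβc K hK L M hL hM n hn hkl hhist).1⟩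

set_option maxHeartbeats 800000 in -- long binders
/-- **ENG-X ⇒ ENG-OSC** (the hypothesis of p2 g25's `hoscAtom_of_engineOsc` / `hoscTAtom_of_engineOsc`: keep `(engine ∧ twoLeg) ∧ osc`, forget the read-outs).
[folklore: projection] -/
theorem engineOsc_of_engineP4X
    (hX : ∃ G : GeoConsts, G.WF ∧ ∀ P : SplitConsts, P.WF → ∀ R : RenConsts, R.WF2 → ∃ Q : EngConsts, Q.WF ∧ ∃ c₃ : ℝ, 0 < c₃ ∧
      ∃ c'' : ℝ, 0 ≤ c'' ∧ ∃ C₀ : ℝ, 0 ≤ C₀ ∧ ∀ c : ℝ, 0 < c → c ≤ c₃ →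
        ∃ U₀ : ℝ, 0 < U₀ ∧ ∃ L₃ : ℝ → ℝ → ℕ, ∃ M₃ : ℝ → ℝ → ℕ → ℕ,
          ∀ μ ∈ klWindowC, ∀ U : ℝ, 0 < U → U ≤ U₀ → ∀ β : ℝ, klBetaMin ≤ β → β ≤ Real.exp (c / U ^ 2) →
            ∀ K : TrigPolyC4v, klPredsV17F2.frameOK R U (nScales β) μ K →
              ∀ (L M : ℕ) [NeZero L] [NeZero M], L₃ β U ≤ L → M₃ β U L ≤ M →
                ∀ n : ℕ, n ≤ nScales β + 1 → IsKLRegime U c (-(n : ℤ)) → HistP klPredsV17F2 L M G P Q R β U μ K n →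
                  (klPredsV17F2.engine L M G P Q β U μ K n ∧ klPredsV17F2.twoLeg L M G P Q R β U μ K n) ∧
                  (∀ m : ℕ, 1 ≤ m → m < n → FlowPieceOscAt L M c'' β U μ m) ∧
                  (∀ k : ℕ, k < n → hubbardEffPartitionFnCT L M β U μ 0 (klFlowFrameU L M β U μ n) (klScale klE0 (k + 1)) ≠ 0) ∧
                  (∀ j : ℕ, j < n → ∀ p : ℕ, 2 ≤ p → ∀ (q : Fin (2 * p)) (w : SpaceTimeIdx L M × SectorLeg (sectorCount j)),
                    klWtPinnedSumAt L M β μ (klFlowFrameU L M β U μ n) j j (2 * p)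
                      (klEffectiveAction L M β U μ (klFlowFrameU L M β U μ n) klE0 (j + 1)) q w ≤ C₀ * klWtBudget P Q U (j + 1) (2 * p)) ∧
                  (∀ j : ℕ, j < n → ∀ (q : Fin 2) (w : SpaceTimeIdx L M × SectorLeg (sectorCount j)),
                    klWtPinnedSumAt L M β μ (klFlowFrameU L M β U μ n) j j 2
                      (klEffectiveAction L M β U μ (klFlowFrameU L M β U μ n) klE0 (j + 1)) q w ≤
                        C₀ * Q.CE * epsCoupling P U n * ((4 : ℝ) ^ (j + 1))⁻¹)) :
    ∃ G : GeoConsts, G.WF ∧ ∀ P : SplitConsts, P.WF → ∀ R : RenConsts, R.WF2 → ∃ Q : EngConsts, Q.WF ∧ ∃ c₃ : ℝ, 0 < c₃ ∧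
      ∃ c'' : ℝ, 0 ≤ c'' ∧ ∀ c : ℝ, 0 < c → c ≤ c₃ →
        ∃ U₀ : ℝ, 0 < U₀ ∧ ∃ L₃ : ℝ → ℝ → ℕ, ∃ M₃ : ℝ → ℝ → ℕ → ℕ,
          ∀ μ ∈ klWindowC, ∀ U : ℝ, 0 < U → U ≤ U₀ → ∀ β : ℝ, klBetaMin ≤ β → β ≤ Real.exp (c / U ^ 2) →
            ∀ K : TrigPolyC4v, klPredsV17F2.frameOK R U (nScales β) μ K →
              ∀ (L M : ℕ) [NeZero L] [NeZero M], L₃ β U ≤ L → M₃ β U L ≤ M →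
                ∀ n : ℕ, n ≤ nScales β + 1 → IsKLRegime U c (-(n : ℤ)) → HistP klPredsV17F2 L M G P Q R β U μ K n →
                  (klPredsV17F2.engine L M G P Q β U μ K n ∧ klPredsV17F2.twoLeg L M G P Q R β U μ K n) ∧
                    ∀ m : ℕ, 1 ≤ m → m < n → FlowPieceOscAt L M c'' β U μ m := by
  obtain ⟨G, hG, hGP⟩ := hX
  refine ⟨G, hG, fun P hP R hR => ?_⟩
  obtain ⟨Q, hQ, c₃, hc₃, c'', hc'', C₀, -, hc⟩ := hGP P hP R hR
  refine ⟨Q, hQ, c₃, hc₃, c'', hc'', fun c hc' hc3 => ?_⟩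
  obtain ⟨U₀, hU₀, L₃, M₃, hmain⟩ := hc c hc' hc3
  refine ⟨U₀, hU₀, L₃, M₃, fun μ hμ U hU hUle β hβ hβc K hK L M _ _ hL hM n hn hkl hhist => ?_⟩
  have h := hmain μ hμ U hU hUle β hβ hβc K hK L M hL hM n hn hkl hhist
  exact ⟨h.1, h.2.1⟩

/-! ## §2 The package-free top-frame export HtopEvenFree′ from the three K3 children («inductionP4»'s tower half verbatim) -/

set_option maxHeartbeats 1600000 in -- long binders
/-- **«(VL)-HE1FREE-SUPPLY»: THE TOP-FRAME EXPORT HtopEvenFree′ FROM THE THREE K3 CHILDREN.**  Children 1 (`BetaSplitP`), 2 (`CountertermP2`) on the covariance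
window and the engine text ENG-X give, for every `(P, R)` (`R` a dummy, `P` entering only through `Klam`), a package `Q₁` (`0 ≤ Q₁.CE`), a constant `C₀ ≥ 0`,
a regime constant `c₇ > 0` and, for `0 < c ≤ c₇`, a coupling threshold `U₇ > 0` such that at every `μ ∈ klWindowC`, `0 < U ≤ U₇`, `klBetaMin ≤ β ≤ exp(c/U²)`,
beyond volume thresholds, at the top flow frame `K_{n_β+1}`: `Z_{Λ_{k+1}} ≠ 0` (`k ≤ n_β`), the read-outs of `𝒱_{j+1}` at `(F_j, rate j)` obey
`≤ C₀·klWtBudget P Q₁ U (j+1) (2p)` (`p ≥ 2`) and `≤ C₀·Q₁.CE·ε_{n_β+1}·4^{−(j+1)}` (degree `2`), `j ≤ n_β`.  Order of choices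
`G → P₁ → R₂ → (Q, c₃, c″, C₀) → (c₀, c₁) → c₇ := min (min c₀ c₁) c₃ → U₇`; per `(μ, U, β)`: the glued strong induction of children 3 + 1 for every admissible frame,
child 2's frame beyond the maxed thresholds, the history at the top, the export at `n = n_β + 1`, the `Klam`-transport `P₁ ↦ P` with `Q₁ := {Q with CE := max 1 r·Q.CE}`.
[cite: BenfattoGiulianiMastropietro2006, §2.8 (2.83), §3] -/
theorem htopFree'_of_children (h₁ : BetaSplitP klPredsV17F2 klWindowC) (h₂ : CountertermP2 klPredsV17F2 klWindowC)
    (hX : ∃ G : GeoConsts, G.WF ∧ ∀ P : SplitConsts, P.WF → ∀ R : RenConsts, R.WF2 → ∃ Q : EngConsts, Q.WF ∧ ∃ c₃ : ℝ, 0 < c₃ ∧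
      ∃ c'' : ℝ, 0 ≤ c'' ∧ ∃ C₀ : ℝ, 0 ≤ C₀ ∧ ∀ c : ℝ, 0 < c → c ≤ c₃ →
        ∃ U₀ : ℝ, 0 < U₀ ∧ ∃ L₃ : ℝ → ℝ → ℕ, ∃ M₃ : ℝ → ℝ → ℕ → ℕ,
          ∀ μ ∈ klWindowC, ∀ U : ℝ, 0 < U → U ≤ U₀ → ∀ β : ℝ, klBetaMin ≤ β → β ≤ Real.exp (c / U ^ 2) →
            ∀ K : TrigPolyC4v, klPredsV17F2.frameOK R U (nScales β) μ K →
              ∀ (L M : ℕ) [NeZero L] [NeZero M], L₃ β U ≤ L → M₃ β U L ≤ M →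
                ∀ n : ℕ, n ≤ nScales β + 1 → IsKLRegime U c (-(n : ℤ)) → HistP klPredsV17F2 L M G P Q R β U μ K n →
                  (klPredsV17F2.engine L M G P Q β U μ K n ∧ klPredsV17F2.twoLeg L M G P Q R β U μ K n) ∧
                  (∀ m : ℕ, 1 ≤ m → m < n → FlowPieceOscAt L M c'' β U μ m) ∧
                  (∀ k : ℕ, k < n → hubbardEffPartitionFnCT L M β U μ 0 (klFlowFrameU L M β U μ n) (klScale klE0 (k + 1)) ≠ 0) ∧
                  (∀ j : ℕ, j < n → ∀ p : ℕ, 2 ≤ p → ∀ (q : Fin (2 * p)) (w : SpaceTimeIdx L M × SectorLeg (sectorCount j)),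
                    klWtPinnedSumAt L M β μ (klFlowFrameU L M β U μ n) j j (2 * p)
                      (klEffectiveAction L M β U μ (klFlowFrameU L M β U μ n) klE0 (j + 1)) q w ≤ C₀ * klWtBudget P Q U (j + 1) (2 * p)) ∧
                  (∀ j : ℕ, j < n → ∀ (q : Fin 2) (w : SpaceTimeIdx L M × SectorLeg (sectorCount j)),
                    klWtPinnedSumAt L M β μ (klFlowFrameU L M β U μ n) j j 2
                      (klEffectiveAction L M β U μ (klFlowFrameU L M β U μ n) klE0 (j + 1)) q w ≤
                        C₀ * Q.CE * epsCoupling P U n * ((4 : ℝ) ^ (j + 1))⁻¹)) :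
    ∀ (P : SplitConsts) (R : RenConsts), P.WF → R.WF2 →
      ∃ Q₁ : EngConsts, 0 ≤ Q₁.CE ∧ ∃ C₀ : ℝ, 0 ≤ C₀ ∧
        ∃ c₇ : ℝ, 0 < c₇ ∧ ∀ c : ℝ, 0 < c → c ≤ c₇ → ∃ U₇ : ℝ, 0 < U₇ ∧
          ∀ μ ∈ klWindowC, ∀ U : ℝ, 0 < U → U ≤ U₇ → ∀ β : ℝ, klBetaMin ≤ β → β ≤ Real.exp (c / U ^ 2) →
            ∃ L₂ : ℕ, ∃ M₂ : ℕ → ℕ, ∀ (L M : ℕ) [NeZero L] [NeZero M], L₂ ≤ L → M₂ L ≤ M →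
              (∀ k, k ≤ nScales β → hubbardEffPartitionFnCT L M β U μ 0 (klFlowFrameU L M β U μ (nScales β + 1)) (klScale klE0 (k + 1)) ≠ 0) ∧
              (∀ j, j ≤ nScales β → ∀ p : ℕ, 2 ≤ p → ∀ (q : Fin (2 * p)) (w : SpaceTimeIdx L M × SectorLeg (sectorCount j)),
                klWtPinnedSumAt L M β μ (klFlowFrameU L M β U μ (nScales β + 1)) j j (2 * p)
                  (klEffectiveAction L M β U μ (klFlowFrameU L M β U μ (nScales β + 1)) klE0 (j + 1)) q w ≤ C₀ * klWtBudget P Q₁ U (j + 1) (2 * p)) ∧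
              (∀ j, j ≤ nScales β → ∀ (q : Fin 2) (w : SpaceTimeIdx L M × SectorLeg (sectorCount j)),
                klWtPinnedSumAt L M β μ (klFlowFrameU L M β U μ (nScales β + 1)) j j 2
                  (klEffectiveAction L M β U μ (klFlowFrameU L M β U μ (nScales β + 1)) klE0 (j + 1)) q w ≤
                    C₀ * Q₁.CE * epsCoupling P U (nScales β + 1) * ((4 : ℝ) ^ (j + 1))⁻¹) := by
  intro P₀ _ hP₀ _
  obtain ⟨G, hG, hEP⟩ := hX
  obtain ⟨P, hP, h₁Q⟩ := h₁ G hG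
  obtain ⟨R, hR2, h₂Q⟩ := h₂ G P hG hP
  have hR : R.WF := hR2.wf
  obtain ⟨Q, hQ, c₃, hc₃, c'', -, C₀, hC₀, hEc⟩ := hEP P hP R hR2
  obtain ⟨c₀, hc₀, h₁c⟩ := h₁Q Q hQ
  obtain ⟨c₁, hc₁, h₂c⟩ := h₂Q Q hQ
  have hCE : 0 ≤ Q.CE := hQ.1
  have hK₀ : 1 ≤ P₀.Klam := hP₀.1
  have hK₁ : 0 ≤ P.Klam := le_trans zero_le_one hP.1
  -- the transported package
  set Q₁ : EngConsts := { Q with CE := max 1 (P.Klam / P₀.Klam) * Q.CE } with hQ₁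
  have hQ₁CE : Q₁.CE = max 1 (P.Klam / P₀.Klam) * Q.CE := rfl
  have hQ₁0 : 0 ≤ Q₁.CE := by rw [hQ₁CE]; exact mul_nonneg (le_trans zero_le_one (le_max_left _ _)) hCE
  refine ⟨Q₁, hQ₁0, C₀, hC₀, min (min c₀ c₁) c₃, lt_min (lt_min hc₀ hc₁) hc₃, fun c hc hc7 => ?_⟩
  have hcc₀ : c ≤ c₀ := hc7.trans ((min_le_left _ _).trans (min_le_left _ _))
  have hcc₁ : c ≤ c₁ := hc7.trans ((min_le_left _ _).trans (min_le_right _ _))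
  have hcc₃ : c ≤ c₃ := hc7.trans (min_le_right _ _)
  obtain ⟨U₃, hU₃, L₃, M₃, h₃main⟩ := hEc c hc hcc₃
  obtain ⟨U₁, hU₁, L₁, M₁, h₁main⟩ := h₁c c hc hcc₀ R hR
  obtain ⟨U₂, hU₂, h₂main⟩ := h₂c c hc hcc₁
  refine ⟨min (min U₁ U₂) U₃, lt_min (lt_min hU₁ hU₂) hU₃, fun μ hμ U hU hUle β hβmin hβc => ?_⟩
  have hU1 : U ≤ U₁ := hUle.trans ((min_le_left _ _).trans (min_le_left _ _))
  have hU2 : U ≤ U₂ := hUle.trans ((min_le_left _ _).trans (min_le_right _ _))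
  have hU3 : U ≤ U₃ := hUle.trans (min_le_right _ _)
  have hKL : ∀ n ≤ nScales β + 1, IsKLRegime U c (-(n : ℤ)) := fun n hn =>
    isKLRegime_of_le_nScales_succ hc.le hβmin hβc hn
  -- the glued induction (children 3 + 1) up to `n_β` for EVERY admissible frame, beyond the maxed hypothesis thresholds
  have hall : ∀ K : TrigPolyC4v, klPredsV17F2.frameOK R U (nScales β) μ K →
      ∀ (L M : ℕ) [NeZero L] [NeZero M], max (L₃ β U) (L₁ β U) ≤ L → max (M₃ β U L) (M₁ β U L) ≤ M →
        ∀ n : ℕ, n ≤ nScales β → (∀ j < n, klPredsV17F2.renorm L M β U μ K R j) →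
          klPredsV17F2.engine L M G P Q β U μ K n ∧ klPredsV17F2.twoLeg L M G P Q R β U μ K n ∧
            klPredsV17F2.split L M G P Q β U μ K n := by
    intro K hK L M _ _ hL hM n hn hRn
    have hL3 : L₃ β U ≤ L := (le_max_left _ _).trans hL
    have hL1 : L₁ β U ≤ L := (le_max_right _ _).trans hL
    have hM3 : M₃ β U L ≤ M := (le_max_left _ _).trans hM
    have hM1 : M₁ β U L ≤ M := (le_max_right _ _).trans hM
    exact Child.allScales (N := nScales β) (KL := fun n => IsKLRegime U c (-(n : ℤ)))
      (B := fun n => klPredsV17F2.split L M G P Q β U μ K n) (Rn := fun n => klPredsV17F2.renorm L M β U μ K R n)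
      (E := fun n => klPredsV17F2.engine L M G P Q β U μ K n) (T := fun n => klPredsV17F2.twoLeg L M G P Q R β U μ K n)
      (fun n hn hkl hyp => (h₃main μ hμ U hU hU3 β hβmin hβc K hK L M hL3 hM3 n (Nat.le_succ_of_le hn) hkl hyp).1)
      (fun n hn hkl hyp hEn hTn => h₁main μ hμ U hU hU1 β hβmin hβc K hK L M hL1 hM1 n hn hkl hyp hEn hTn)
      (fun n hn => hKL n (Nat.le_succ_of_le hn)) n hn hRn
  -- child 2: the volume-uniform renormalised admissible frame and its thresholds
  obtain ⟨K, hK, Lc, Mc, hKR⟩ :=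
    h₂main μ hμ U hU hU2 β hβmin hβc (max (L₃ β U) (L₁ β U)) (fun L => max (M₃ β U L) (M₁ β U L)) hall
  refine ⟨max Lc (max (L₃ β U) (L₁ β U)), fun L => max (Mc L) (max (M₃ β U L) (M₁ β U L)), fun L M _ _ hL hM => ?_⟩
  have hLc : Lc ≤ L := (le_max_left _ _).trans hL
  have hLh : max (L₃ β U) (L₁ β U) ≤ L := (le_max_right _ _).trans hL
  have hL3 : L₃ β U ≤ L := (le_max_left _ _).trans hLh
  have hMc : Mc L ≤ M := (le_max_left _ _).trans hM
  have hMh : max (M₃ β U L) (M₁ β U L) ≤ M := (le_max_right _ _).trans hM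
  have hM3 : M₃ β U L ≤ M := (le_max_left _ _).trans hMh
  -- the tower of K at (L, M) up to `n_β`, hence the history at the top
  have hle : ∀ n : ℕ, n ≤ nScales β →
      klPredsV17F2.renorm L M β U μ K R n ∧ klPredsV17F2.split L M G P Q β U μ K n ∧
        klPredsV17F2.engine L M G P Q β U μ K n ∧ klPredsV17F2.twoLeg L M G P Q R β U μ K n := by
    intro n hn
    have h := hall K hK L M hLh hMh n hn fun j hj => hKR L M hLc hMc j (le_of_lt (lt_of_lt_of_le hj hn))
    exact ⟨hKR L M hLc hMc n hn, h.2.2, h.1, h.2.1⟩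
  have hhist : HistP klPredsV17F2 L M G P Q R β U μ K (nScales β + 1) := by
    intro j hj
    have h := hle j (Nat.lt_succ_iff.mp hj)
    exact ⟨h.2.1, h.1, h.2.2.1, h.2.2.2⟩
  -- the export at the top index, then the `Klam`-transport `P ↦ P₀`
  obtain ⟨-, -, hZ, hR4, hR2⟩ := h₃main μ hμ U hU hU3 β hβmin hβc K hK L M hL3 hM3 (nScales β + 1) le_rfl (hKL _ le_rfl) hhist
  refine ⟨fun k hk => hZ k (Nat.lt_succ_of_le hk), fun j hj p hp q w => ?_, fun j hj q w => ?_⟩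
  · refine (hR4 j (Nat.lt_succ_of_le hj) p hp q w).trans (mul_le_mul_of_nonneg_left ?_ hC₀)
    exact klWtBudget_two_mul_le_rescale hCE hK₀ hK₁ U (j + 1) (le_trans one_le_two hp)
  · refine (hR2 j (Nat.lt_succ_of_le hj) q w).trans ?_
    have h4 : (0 : ℝ) ≤ ((4 : ℝ) ^ (j + 1))⁻¹ := by positivity
    have h := ce_mul_epsCoupling_le_rescale (Q := Q) hCE hK₀ hK₁ U (nScales β + 1)
    calc C₀ * Q.CE * epsCoupling P U (nScales β + 1) * ((4 : ℝ) ^ (j + 1))⁻¹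
        = C₀ * (Q.CE * epsCoupling P U (nScales β + 1)) * ((4 : ℝ) ^ (j + 1))⁻¹ := by ring
      _ ≤ C₀ * (max 1 (P.Klam / P₀.Klam) * Q.CE * epsCoupling P₀ U (nScales β + 1)) * ((4 : ℝ) ^ (j + 1))⁻¹ :=
          mul_le_mul_of_nonneg_right (mul_le_mul_of_nonneg_left h hC₀) h4
      _ = C₀ * Q₁.CE * epsCoupling P₀ U (nScales β + 1) * ((4 : ℝ) ^ (j + 1))⁻¹ := by rw [hQ₁CE]; ring

end Summit.HubbardSuperconductivity.HubbardSuperconductivity.Theorems.KLRegimeSplit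

end
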